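import Literature.ComputerArithmetic.Rump2006.CholeskyStoredZeros
import Literature.ComputerArithmetic.Rump2006.CholeskyReciprocalDivisionSharpCriteria

/-!
# Stored zeros over a RECIPROCAL-SCALING Cholesky: the library-shape run with flushed quotients is a
# `CholeskyRunRecip` of a nearby symmetric matrix, and Rump's criteria hold with the printed constants

HONEST FRAMING (cell certnum, L1; seat certnum-ila-3, at the request of certnum-ila-1, author of
cap.ila.spd): tools and soundness statements; every certified number belongs to a client cell's
ledger. `CholeskyStoredZeros` (certnum-ila-1) treats stored zeros of a sparse factor over the
TEXTBOOK run (one true division per off-diagonal entry); `CholeskyReciprocalDivision{,Sharp,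
SharpCriteria}` (this seat) treat the LIBRARY shape (the off-diagonal step multiplies by a rounded
reciprocal, `r̃_{ij} = fl(s̃ · fl(1/r̃_{ii}))`) with the printed constants. A CHOLMOD supernodal
factor has BOTH features: dense LAPACK `dpotrf`/`dtrsm` inside the supernodes (reciprocal scaling)
and explicitly stored zeros (exact or flushed). This module composes the two:
* `CholeskyRunRecipFlush u E A R̃` — off-diagonal entry = the reciprocal step OR a stored zero with
  numerator `|s̃| ≤ E_{ij}`; it contains `CholeskyRunRecip` (`toRecipFlush`) and `CholeskyRunFlush`
  (`CholeskyRunFlush.toRecipFlush`: an exact reciprocal);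
* `CholeskyRunRecipFlush.exists_choleskyRunRecip` — such a run IS a `CholeskyRunRecip u` (same `R̃`)
  of a SYMMETRIC `A'` with the same diagonal and `|A' - A| (1-u)^n ≤ E` (certnum-ila-1's re-centring
  `CTree.exists_recentre` verbatim: it only moves the numerator tree);
* `quadForm_pos_of_shifted_cholesky_recip_flush_sharp` / `posDef_of_shifted_cholesky_recip_flush_sharp`
  — [Rump2006] Corollary 2.7 / [Rump2010Verification] Lemma 10.14 (and the point case as Mathlib
  `Matrix.PosDef`) for such a run with the PRINTED constants (`u`, not `2u+u²`; via
  `CholeskyRunRecip.neg_mul_lt_quadForm` of `…SharpCriteria`), the flush allowance entering only as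
  the extra radius `r_E` with its own Collatz pair, exactly as in `quadForm_pos_of_shifted_cholesky_flush`.
No named facts, no `sorry`. WHAT IS NOT HERE: as in the parents (eta terms beyond the flushed
quotients, complex data, TRSM-by-block-inversion, the IEEE formats).
-/

namespace Literature.ComputerArithmetic.Rump2006

open Finset Matrix
open Literature.ComputerArithmetic.Higham2002

variable {K : Type*} [Field K] [LinearOrder K] [IsStrictOrderedRing K]

section RecipFlush

variable {u : K} {n : ℕ}

/-- A floating-point Cholesky run of LIBRARY SHAPE (reciprocal pivot scaling, `CholeskyRunRecip`)
in which an off-diagonal entry may also be a STORED ZERO with an absolutely bounded numerator,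
`r̃_{ij} = 0`, `|s̃| ≤ E_{ij}` (`CholeskyRunFlush`): what a CHOLMOD supernodal factor with explicit
zeros certifies under the standard model with gradual underflow.
[cite: Rump2006, (1.1), (2.1) and (2.6)] [cite: Higham2002ASNA, Algorithm 10.2 and (2.4)] -/
structure CholeskyRunRecipFlush (u : K) (E A R : Matrix (Fin n) (Fin n) K) : Prop where
  lower : ∀ i j : Fin n, j < i → R i j = 0
  offDiag : ∀ i j : Fin n, i < j → ∃ e : CTree K, e.WF u ∧ e.const = A i j ∧
    e.terms.Perm (prods R i j) ∧ R i i ≠ 0 ∧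
    ((∃ w : K, |w - (R i i)⁻¹| ≤ u * |(R i i)⁻¹| ∧ |R i j - e.val * w| ≤ u * |e.val * w|) ∨
      (R i j = 0 ∧ |e.val| ≤ E i j))
  diag : ∀ j : Fin n, ∃ e : CTree K, e.WF u ∧ e.const = A j j ∧ e.terms.Perm (prods R j j) ∧
    ∃ δ : K, |δ| ≤ u ∧ R j j ^ 2 = e.val * (1 + δ) ^ 2

omit [IsStrictOrderedRing K] in
/-- a reciprocal run is a reciprocal flush run for every allowance. [cite: Rump2006, (2.1) and (2.6)] -/
theorem CholeskyRunRecip.toRecipFlush {E A R : Matrix (Fin n) (Fin n) K} (h : CholeskyRunRecip u A R) :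
    CholeskyRunRecipFlush u E A R where
  lower := h.lower
  offDiag i j hij := by
    obtain ⟨e, he, hc, hp, hii, hr⟩ := h.offDiag i j hij
    exact ⟨e, he, hc, hp, hii, Or.inl hr⟩
  diag := h.diag

/-- a textbook flush run (one true division) is a reciprocal flush run with the EXACT reciprocal.
[cite: Rump2006, (2.1) and (2.6)] -/
theorem CholeskyRunFlush.toRecipFlush (hu : 0 ≤ u) {E A R : Matrix (Fin n) (Fin n) K}
    (h : CholeskyRunFlush u E A R) : CholeskyRunRecipFlush u E A R where
  lower := h.lower
  offDiag i j hij := by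
    obtain ⟨e, he, hc, hp, hii, hr⟩ := h.offDiag i j hij
    refine ⟨e, he, hc, hp, hii, ?_⟩
    rcases hr with hr | hz
    · refine Or.inl ⟨(R i i)⁻¹, ?_, ?_⟩
      · rw [sub_self, abs_zero]; exact mul_nonneg hu (abs_nonneg _)
      · rw [← div_eq_mul_inv]; exact hr
    · exact Or.inr hz
  diag := h.diag

/-- the per-entry re-centring (certnum-ila-1's `CTree.exists_recentre`) for the reciprocal shape: in
stage `(i, j)`, `i < j`, of a reciprocal flush run there is a datum `c` with `|c - a_{ij}| (1-u)^n ≤ E_{ij}`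
for which the SAME `r̃_{ij}` is a standard-model reciprocal step (a stored zero becomes the exact zero
numerator times the exact reciprocal). [cite: Rump2006, Lemma 2.1 and (1.1)] [cite: Higham2002ASNA, Lemma 8.4] -/
theorem CholeskyRunRecipFlush.exists_const (hu : 0 ≤ u) (hu1 : u < 1)
    {E A R : Matrix (Fin n) (Fin n) K} (hE0 : ∀ i j, 0 ≤ E i j) (h : CholeskyRunRecipFlush u E A R)
    (i j : Fin n) (hij : i < j) :
    ∃ c : K, (∃ e : CTree K, e.WF u ∧ e.const = c ∧ e.terms.Perm (prods R i j) ∧ R i i ≠ 0 ∧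
      ∃ w : K, |w - (R i i)⁻¹| ≤ u * |(R i i)⁻¹| ∧ |R i j - e.val * w| ≤ u * |e.val * w|) ∧
      |c - A i j| * (1 - u) ^ n ≤ E i j := by
  obtain ⟨e, he, hc, hp, hii, hr⟩ := h.offDiag i j hij
  rcases hr with hr | ⟨hz, hE⟩
  · refine ⟨A i j, ⟨e, he, hc, hp, hii, hr⟩, ?_⟩
    rw [sub_self, abs_zero, zero_mul]
    exact hE0 i j
  · obtain ⟨e', he', hterms, hval, hconst⟩ := CTree.exists_recentre hu hu1 e he e.val
    have hlen : e.terms.length = i.val := by rw [hp.length_eq, CholeskyRun.length_prods]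
    refine ⟨e'.const, ⟨e', he', rfl, hterms ▸ hp, hii, (R i i)⁻¹, ?_, ?_⟩, ?_⟩
    · rw [sub_self, abs_zero]; exact mul_nonneg hu (abs_nonneg _)
    · rw [hval, sub_self, zero_mul, hz, sub_zero, abs_zero, mul_zero]
    · have h1u : 0 < 1 - u := by linarith
      have hpow : (1 - u) ^ n ≤ (1 - u) ^ e.terms.length :=
        pow_le_pow_of_le_one h1u.le (by linarith) (by rw [hlen]; exact i.isLt.le)
      calc |e'.const - A i j| * (1 - u) ^ n
          ≤ |e'.const - A i j| * (1 - u) ^ e.terms.length :=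
            mul_le_mul_of_nonneg_left hpow (abs_nonneg _)
        _ = |e'.const - e.const| * (1 - u) ^ e.terms.length := by rw [hc]
        _ ≤ |e.val| := hconst
        _ ≤ E i j := hE

/-- STORED ZEROS COST A RADIUS, NOT THE THEOREM — LIBRARY SHAPE: a reciprocal flush run of a symmetric
`A` with allowance `E ≥ 0` is a `CholeskyRunRecip u` (same computed factor `R̃`) of a SYMMETRIC `A'`
with the same diagonal and `|A' - A| (1-u)^n ≤ E` entrywise (`E` read symmetrically).
[cite: Rump2006, Lemma 2.1, (1.1) and Corollary 2.7] [cite: Higham2002ASNA, Lemma 8.4] -/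
theorem CholeskyRunRecipFlush.exists_choleskyRunRecip (hu : 0 ≤ u) (hu1 : u < 1)
    {E A R : Matrix (Fin n) (Fin n) K} (hA : Aᵀ = A) (hE0 : ∀ i j, 0 ≤ E i j)
    (h : CholeskyRunRecipFlush u E A R) :
    ∃ A' : Matrix (Fin n) (Fin n) K, A'ᵀ = A' ∧ CholeskyRunRecip u A' R ∧ (∀ i, A' i i = A i i) ∧
      ∀ i j, |A' i j - A i j| * (1 - u) ^ n ≤ (if i < j then E i j else E j i) := by
  classical
  have hsym : ∀ i j, A i j = A j i := fun i j => by
    have := congrFun (congrFun hA j) i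
    rwa [Matrix.transpose_apply] at this
  let c : ∀ i j : Fin n, i < j → K := fun i j hij => Classical.choose (h.exists_const hu hu1 hE0 i j hij)
  have hc : ∀ i j (hij : i < j), (∃ e : CTree K, e.WF u ∧ e.const = c i j hij ∧
      e.terms.Perm (prods R i j) ∧ R i i ≠ 0 ∧
      ∃ w : K, |w - (R i i)⁻¹| ≤ u * |(R i i)⁻¹| ∧ |R i j - e.val * w| ≤ u * |e.val * w|) ∧
      |c i j hij - A i j| * (1 - u) ^ n ≤ E i j :=
    fun i j hij => Classical.choose_spec (h.exists_const hu hu1 hE0 i j hij)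
  let A' : Matrix (Fin n) (Fin n) K := fun i j =>
    if hij : i < j then c i j hij else if hji : j < i then c j i hji else A i j
  have hup : ∀ i j (hij : i < j), A' i j = c i j hij := fun i j hij => by
    simp only [A', dif_pos hij]
  have hlo : ∀ i j (hji : j < i), A' i j = c j i hji := fun i j hji => by
    simp only [A', dif_neg (lt_asymm hji), dif_pos hji]
  have hdg : ∀ i, A' i i = A i i := fun i => by
    simp only [A', dif_neg (lt_irrefl i)]
  refine ⟨A', ?_, ⟨h.lower, ?_, ?_⟩, hdg, ?_⟩
  · ext i j
    rw [Matrix.transpose_apply]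
    rcases lt_trichotomy i j with hij | rfl | hji
    · rw [hup i j hij, hlo j i hij]
    · rfl
    · rw [hlo i j hji, hup j i hji]
  · intro i j hij
    obtain ⟨⟨e, he, hce, hp, hii, hr⟩, -⟩ := hc i j hij
    exact ⟨e, he, by rw [hce, hup i j hij], hp, hii, hr⟩
  · intro j
    obtain ⟨e, he, hce, hp, hδ⟩ := h.diag j
    exact ⟨e, he, by rw [hce, hdg], hp, hδ⟩
  · intro i j
    rcases lt_trichotomy i j with hij | rfl | hji
    · rw [if_pos hij, hup i j hij]; exact (hc i j hij).2
    · rw [if_neg (lt_irrefl i), hdg, sub_self, abs_zero, zero_mul]; exact hE0 i i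
    · rw [if_neg (lt_asymm hji), hlo i j hji, hsym i j]; exact (hc j i hji).2

/-- [Rump2006] COROLLARY 2.7 / [Rump2010Verification] LEMMA 10.14 FOR A LIBRARY-SHAPE FACTOR WITH STORED
ZEROS, PRINTED CONSTANTS: `[A - Rad, A + Rad]` a symmetric interval matrix (`Rad = Radᵀ ≥ 0`, Collatz
pair `Rad w ≤ r w`, `w > 0`), `Ã = Ãᵀ` agreeing with `A` off the diagonal with `ã_{ii} ≤ a_{ii} - c - r - r_E`;
the Cholesky of `Ã` WITH RECIPROCAL PIVOT SCALING runs to completion in any order with positive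
computed pivots, every stored off-diagonal zero having a numerator `|s̃_{ij}| ≤ E_{ij}` (`E = Eᵀ ≥ 0`,
Collatz pair `E v ≤ r_E (1-u)^n v`, `v > 0`), and `Σ_j φ_{j+2} ã_{jj} ≤ c` (φ AT `u`). Then EVERY `X`
with `|X - A| ≤ Rad` satisfies `yᵀ X y > 0` for `y ≠ 0`.
[cite: Rump2006, Corollary 2.7 and (1.1)] [cite: Rump2010Verification, Lemma 10.14] -/
theorem quadForm_pos_of_shifted_cholesky_recip_flush_sharp (hu : 0 ≤ u)
    (h2n : 2 * ((n : K) + 1) * u < 1) {A At R E Rad : Matrix (Fin n) (Fin n) K} (hAt : Atᵀ = At)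
    (hE : Eᵀ = E) (hE0 : ∀ i j, 0 ≤ E i j) (hrun : CholeskyRunRecipFlush u E At R)
    (hpos : ∀ j, 0 < R j j) {v : Fin n → K} (hv : ∀ i, 0 < v i) {rE : K}
    (hrE : ∀ i, (E *ᵥ v) i ≤ rE * (1 - u) ^ n * v i) (hRad : Radᵀ = Rad)
    (hRad0 : ∀ i j, 0 ≤ Rad i j) {w : Fin n → K} (hw : ∀ i, 0 < w i) {r : K}
    (hr : ∀ i, (Rad *ᵥ w) i ≤ r * w i) {c : K} (hoff : ∀ i j, i ≠ j → At i j = A i j)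
    (hdiag : ∀ i, At i i ≤ A i i - c - r - rE)
    (hc : ∑ j : Fin n, gamma u (j.val + 2) / (1 - gamma u (j.val + 2)) * At j j ≤ c)
    (X : Matrix (Fin n) (Fin n) K) (hX : ∀ i j, |X i j - A i j| ≤ Rad i j)
    (y : Fin n → K) (hy : y ≠ 0) : 0 < y ⬝ᵥ (X *ᵥ y) := by
  have hu1 : u < 1 := by
    have hn : (1 : K) ≤ (n : K) + 1 := by
      have := Nat.cast_nonneg (α := K) n; linarith
    nlinarith
  have h1u : 0 < (1 - u) ^ n := pow_pos (by linarith) n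
  have hEsym : ∀ i j, E i j = E j i := fun i j => by
    have := congrFun (congrFun hE j) i
    rwa [Matrix.transpose_apply] at this
  obtain ⟨A', hA', hrun', hdg, hbd⟩ := hrun.exists_choleskyRunRecip hu hu1 hAt hE0
  let RadE : Matrix (Fin n) (Fin n) K := fun i j => E i j / (1 - u) ^ n
  let A0 : Matrix (Fin n) (Fin n) K := fun i j => A i j + (A' i j - At i j)
  have hRadE : RadEᵀ = RadE := by
    ext i j; simp only [RadE, Matrix.transpose_apply, hEsym i j]
  have hRadE0 : ∀ i j, 0 ≤ RadE i j := fun i j => div_nonneg (hE0 i j) h1u.le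
  have hrv : ∀ i, (RadE *ᵥ v) i ≤ rE * v i := by
    intro i
    have hmv : (RadE *ᵥ v) i = (E *ᵥ v) i / (1 - u) ^ n := by
      simp only [RadE, Matrix.mulVec, dotProduct, Finset.sum_div]
      exact Finset.sum_congr rfl fun j _ => by ring
    rw [hmv, div_le_iff₀ h1u]
    calc (E *ᵥ v) i ≤ rE * (1 - u) ^ n * v i := hrE i
      _ = rE * v i * (1 - u) ^ n := by ring
  have hoff' : ∀ i j, i ≠ j → A' i j = A0 i j := fun i j hij => by
    simp only [A0, hoff i j hij]; ring
  have hdiag' : ∀ i, A' i i ≤ A0 i i - (c + r + rE) := fun i => by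
    simp only [A0, hdg i]; linarith [hdiag i]
  have hc' : ∑ j : Fin n, gamma u (j.val + 2) / (1 - gamma u (j.val + 2)) * A' j j ≤ c := by
    simpa only [hdg] using hc
  have hAA0 : ∀ i j, |A i j - A0 i j| ≤ RadE i j := by
    intro i j
    have h1 : |A i j - A0 i j| = |A' i j - At i j| := by
      simp only [A0]; rw [← abs_neg]; ring_nf
    rw [h1, le_div_iff₀ h1u]
    have h2 := hbd i j
    rcases lt_trichotomy i j with hij | rfl | hji
    · simpa only [if_pos hij] using h2
    · simpa only [if_neg (lt_irrefl i)] using h2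
    · simpa only [if_neg (lt_asymm hji), hEsym j i] using h2
  have hX0 : ∀ i j, |X i j - A0 i j| ≤ (Rad + RadE) i j := fun i j => by
    rw [Matrix.add_apply]
    calc |X i j - A0 i j| = |(X i j - A i j) + (A i j - A0 i j)| := by ring_nf
      _ ≤ |X i j - A i j| + |A i j - A0 i j| := abs_add_le _ _
      _ ≤ Rad i j + RadE i j := add_le_add (hX i j) (hAA0 i j)
  have h1 := hrun'.neg_mul_lt_quadForm hu h2n hA' hpos y hy
  have h2 := quadForm_shift_le (d := c + r + rE) hoff' hdiag' y
  have h3 := quadForm_sub_abs_le hX0 y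
  have hsplit : (fun i => |y i|) ⬝ᵥ ((Rad + RadE) *ᵥ fun i => |y i|) =
      (fun i => |y i|) ⬝ᵥ (Rad *ᵥ fun i => |y i|) +
        (fun i => |y i|) ⬝ᵥ (RadE *ᵥ fun i => |y i|) := by
    rw [Matrix.add_mulVec, dotProduct_add]
  rw [hsplit] at h3
  have h4 := quadForm_le_of_mulVec_le hRad hRad0 hw hr (fun i => |y i|)
  have h5 := quadForm_le_of_mulVec_le hRadE hRadE0 hv hrv (fun i => |y i|)
  have hyy : (fun i => |y i|) ⬝ᵥ (fun i => |y i|) = y ⬝ᵥ y := by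
    simp only [dotProduct]; exact sum_congr rfl fun i _ => abs_mul_abs_self _
  rw [hyy] at h4 h5
  have hxx : 0 ≤ y ⬝ᵥ y := sum_nonneg fun i _ => mul_self_nonneg _
  nlinarith [mul_le_mul_of_nonneg_right hc' hxx]

/-- Over `ℝ`, the point case (`Rad = 0`) packaged as Mathlib's `Matrix.PosDef`: the sparse-Cholesky
lambda_min floor of a LIBRARY-SHAPE (CHOLMOD / LAPACK supernodes) factor with STORED ZEROS CHARGED as
the extra radius `r_E`, at the PRINTED constants (`u`). The statement cap.ila.spd may cite for both
hypothesis repairs at once (reciprocal pivot scaling + stored zeros).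
[cite: Rump2006, Corollary 2.4 and Corollary 2.7] [cite: Rump2010Verification, Section 10.8.1] -/
theorem posDef_of_shifted_cholesky_recip_flush_sharp {n : ℕ} {u : ℝ} (hu : 0 ≤ u)
    (h2n : 2 * ((n : ℝ) + 1) * u < 1) {A At R E : Matrix (Fin n) (Fin n) ℝ} (hAt : Atᵀ = At)
    (hE : Eᵀ = E) (hE0 : ∀ i j, 0 ≤ E i j) (hrun : CholeskyRunRecipFlush u E At R)
    (hpos : ∀ j, 0 < R j j) {v : Fin n → ℝ} (hv : ∀ i, 0 < v i) {rE c : ℝ}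
    (hrE : ∀ i, (E *ᵥ v) i ≤ rE * (1 - u) ^ n * v i) (hoff : ∀ i j, i ≠ j → At i j = A i j)
    (hdiag : ∀ i, At i i ≤ A i i - c - rE)
    (hc : ∑ j : Fin n, gamma u (j.val + 2) / (1 - gamma u (j.val + 2)) * At j j ≤ c) :
    A.PosDef := by
  have hA : A.IsHermitian := by
    rw [Matrix.IsHermitian, Matrix.conjTranspose_eq_transpose_of_trivial]
    ext i j
    rw [Matrix.transpose_apply]
    by_cases hij : i = j
    · rw [hij]
    · have h1 := hoff j i (Ne.symm hij)
      have h2 := hoff i j hij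
      have h3 : At j i = At i j := by
        have := congrFun (congrFun hAt i) j
        rw [Matrix.transpose_apply] at this
        exact this
      rw [← h1, h3, h2]
  refine Matrix.PosDef.of_dotProduct_mulVec_pos hA fun x hx => ?_
  rw [star_trivial]
  have hRad : (0 : Matrix (Fin n) (Fin n) ℝ)ᵀ = 0 := Matrix.transpose_zero
  have hr : ∀ i, ((0 : Matrix (Fin n) (Fin n) ℝ) *ᵥ v) i ≤ 0 * v i := fun i => by
    rw [Matrix.zero_mulVec, zero_mul]; exact le_rfl
  exact quadForm_pos_of_shifted_cholesky_recip_flush_sharp hu h2n hAt hE hE0 hrun hpos hv hrE hRad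
    (fun _ _ => le_rfl) hv hr hoff (fun i => by linarith [hdiag i]) hc A
    (fun i j => by rw [sub_self, abs_zero]; exact le_rfl) x hx

/-- Sanity (non-vacuity beyond `CholeskyRunRecip`): with `u = 0` the `2 × 2` datum `Ã = [[4, 1], [1, 4]]`
and the factor `R̃ = [[2, 0], [0, 2]]` — whose `(0,1)` entry is a STORED ZERO although the exact
quotient is `1/2` — form a reciprocal flush run with allowance `E_{01} = 1` (numerator `s̃ = 1`). -/
example : CholeskyRunRecipFlush (0 : ℚ) !![0, (1 : ℚ); 1, 0] !![(4 : ℚ), 1; 1, 4] !![(2 : ℚ), 0; 0, 2]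
    where
  lower i j h := by
    fin_cases i <;> fin_cases j <;> simp_all
  offDiag i j h := by
    fin_cases i <;> fin_cases j
    · exact absurd h (lt_irrefl _)
    · refine ⟨CTree.start 1, trivial, by simp [CTree.const], by simp [CTree.terms, prods], by simp, ?_⟩
      right
      simp [CTree.val]
    · exact absurd (Fin.lt_def.mp h) (by norm_num)
    · exact absurd h (lt_irrefl _)
  diag j := by
    fin_cases j
    · refine ⟨CTree.start 4, trivial, by simp [CTree.const], by simp [CTree.terms, prods], 0,
        by simp, ?_⟩
      simp [CTree.val]; norm_num
    · refine ⟨CTree.fsub 4 (CTree.start 4) 0, ⟨trivial, by simp [CTree.val]⟩, by simp [CTree.const],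
        ?_, 0, by simp, ?_⟩
      · simp [CTree.terms, prods]
      · simp [CTree.val]; norm_num

end RecipFlush

end Literature.ComputerArithmetic.Rump2006
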